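import Mathlib.Analysis.Complex.Basic
import Mathlib.Analysis.RCLike.Lemmas
import Mathlib.FieldTheory.Minpoly.Field
import Mathlib.LinearAlgebra.Complex.Module
import HarnessLib

/-!
# Real-algebra embeddings `𝕜 → ℂ` for `𝕜 = ℝ` or `ℂ`, and `τ`-projectors

Trunk: AutomorphicL (support for `Literature.NumberTheory.Automorphic.HarishChandraGL`, the proof of
`Literature.NumberTheory.Automorphic.nonempty_harishChandraHomGL`).

For `𝕜` with `[RCLike 𝕜]` let `T = (𝕜 →ₐ[ℝ] ℂ)` (a `Fintype` by `minpoly.AlgHom.fintype`). This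
file makes the isomorphism `𝕜 ⊗_ℝ ℂ ≅ ∏_{τ ∈ T} ℂ` usable without tensor products:

* if `RCLike.I = 0` (`𝕜 ≅ ℝ`) then `T = {re}` has one element;
* otherwise (`𝕜 ≅ ℂ`) `T = {τ₊, τ₋}` has two elements, with `τ_±(I) = ± i`.

Uniformly in both cases: `∑_τ τ(I) = 0`, `conj (τ I) = -τ I`, and the *orthogonality relation*
`|T|⁻¹ (1 + conj(τ I) τ'(I)) = δ_{ττ'}`. Consequently, for a real-linear map `ρ` from a
`𝕜`-module `M` to a complex vector space `W`, the *`τ`-projector*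
`proj ρ τ X = |T|⁻¹ (ρ X + conj(τ I) ρ(I • X))` is the `τ`-component of the complex-linear
extension of `ρ` to `M ⊗_ℝ ℂ ≅ ⨁_τ (M ⊗_{𝕜,τ} ℂ)`: `∑_τ proj ρ τ = ρ` and
`proj ρ τ (a • X) = τ(a) • proj ρ τ X`. For the Lie algebra `𝔤𝔩ₙ(𝕜)` this realises the
decomposition `𝔤𝔩ₙ(𝕜) ⊗_ℝ ℂ ≅ ∏_τ 𝔤𝔩ₙ(ℂ)` of Knapp, *Lie Groups Beyond an Introduction*, §VI.1
(complexification of a real form), used with the labelling of Clozel 1990, §3.3 and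
Buzzard–Gee 2014, §3.1 (`τ : 𝕜 ↪ ℂ`).

## Main definitions

* `Literature.Automorphic.HCEmb.proj ρ τ` — the `τ`-projector of a real-linear map `ρ : M →ₗ[ℝ] W`.

## Main statements

* `Literature.NumberTheory.Automorphic.HCEmb.algHom_apply_eq`, `conj_algHom_I`, `sum_algHom_I`, `orthogonality`,
  `orthogonality_sum` — structure of `T`.
* `Literature.NumberTheory.Automorphic.HCEmb.sum_proj`, `proj_smul` — `∑_τ proj ρ τ = ρ`, `τ`-semilinearity.

## References

* A. W. Knapp, *Lie Groups Beyond an Introduction*, 2nd ed., Birkhäuser 2002, §VI.1.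
* L. Clozel, *Motifs et formes automorphes*, 1990, §3.3.
-/

open scoped ComplexConjugate

noncomputable section

namespace Literature.NumberTheory.Automorphic.HCEmb

open RCLike

variable {𝕜 : Type*} [RCLike 𝕜]

/-! ### The set of real-algebra maps `𝕜 → ℂ` -/

/-- A real-algebra map `τ : 𝕜 → ℂ` is `τ a = re a + im a · τ(I)`. [folklore] -/
theorem algHom_apply_eq (τ : 𝕜 →ₐ[ℝ] ℂ) (a : 𝕜) :
    τ a = (re a : ℂ) + (im a : ℂ) * τ I := by
  conv_lhs => rw [← re_add_im a]
  rw [map_add, map_mul, AlgHom.commutes, AlgHom.commutes]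
  rfl

/-- Two real-algebra maps `𝕜 → ℂ` that agree on `I` are equal. [folklore] -/
theorem algHom_ext_I {τ τ' : 𝕜 →ₐ[ℝ] ℂ} (h : τ I = τ' I) : τ = τ' := by
  ext a
  rw [algHom_apply_eq τ, algHom_apply_eq τ', h]

/-- `τ(I)` is `0` (real case) or `± i` (complex case). [folklore] -/
theorem algHom_I_eq (τ : 𝕜 →ₐ[ℝ] ℂ) :
    ((I : 𝕜) = 0 ∧ τ I = 0) ∨ ((I : 𝕜) * I = -1 ∧ (τ I = Complex.I ∨ τ I = -Complex.I)) := by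
  rcases RCLike.I_mul_I_ax (K := 𝕜) with h | h
  · exact Or.inl ⟨h, by rw [h, map_zero]⟩
  · refine Or.inr ⟨h, ?_⟩
    have h2 : τ I ^ 2 = Complex.I ^ 2 := by
      rw [sq, sq, ← map_mul, h, map_neg, map_one, Complex.I_mul_I]
    exact eq_or_eq_neg_of_sq_eq_sq _ _ h2

/-- `conj (τ I) = -τ I` for every real-algebra map `τ : 𝕜 → ℂ`. [folklore] -/
theorem conj_algHom_I (τ : 𝕜 →ₐ[ℝ] ℂ) : conj (τ I) = -τ I := by
  rcases algHom_I_eq τ with ⟨-, h⟩ | ⟨-, h | h⟩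
  · rw [h, map_zero, neg_zero]
  · rw [h, Complex.conj_I]
  · rw [h, map_neg, Complex.conj_I, neg_neg]

/-- `conj (τ I) * τ I = 1` unless `I = 0`. [folklore] -/
theorem conj_algHom_I_mul_self (τ : 𝕜 →ₐ[ℝ] ℂ) (hI : (I : 𝕜) ≠ 0) : conj (τ I) * τ I = 1 := by
  rcases algHom_I_eq τ with ⟨h0, -⟩ | ⟨-, h | h⟩
  · exact absurd h0 hI
  · rw [h, Complex.conj_I]; ring_nf; rw [Complex.I_sq]; ring
  · rw [h, map_neg, Complex.conj_I]; ring_nf; rw [Complex.I_sq]; ring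

/-- In the real case (`I = 0`) all real-algebra maps `𝕜 → ℂ` coincide. [folklore] -/
theorem algHom_eq_of_I_eq_zero (hI : (I : 𝕜) = 0) (τ τ' : 𝕜 →ₐ[ℝ] ℂ) : τ = τ' :=
  algHom_ext_I (by rw [hI, map_zero, map_zero])

/-- The real-part embedding `𝕜 → ℂ`, a real-algebra map when `I = 0`. [folklore] -/
def reAlgHom (hI : (I : 𝕜) = 0) : 𝕜 →ₐ[ℝ] ℂ :=
  { (algebraMap ℝ ℂ).comp (realRingEquiv hI).toRingHom with
    commutes' := fun r ↦ by simp }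

/-- The embedding `a ↦ re a + im a · i`, a real-algebra map when `im I = 1`. [folklore] -/
def posAlgHom (hI : im (I : 𝕜) = 1) : 𝕜 →ₐ[ℝ] ℂ :=
  { (complexRingEquiv hI).toRingHom with
    commutes' := fun r ↦ by simp }

/-- The conjugate embedding `a ↦ re a - im a · i`. [folklore] -/
def negAlgHom (hI : im (I : 𝕜) = 1) : 𝕜 →ₐ[ℝ] ℂ :=
  (Complex.conjAe.toAlgHom).comp (posAlgHom hI)

/-- `posAlgHom` sends `I` to `i`. [folklore] -/
@[simp] theorem posAlgHom_I (hI : im (I : 𝕜) = 1) : posAlgHom hI I = Complex.I := by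
  simp [posAlgHom, hI]

/-- `negAlgHom` sends `I` to `-i`. [folklore] -/
@[simp] theorem negAlgHom_I (hI : im (I : 𝕜) = 1) : negAlgHom hI I = -Complex.I := by
  simp [negAlgHom]

/-- The two embeddings of the complex case are distinct. [folklore] -/
theorem posAlgHom_ne_negAlgHom (hI : im (I : 𝕜) = 1) : posAlgHom hI ≠ negAlgHom hI := by
  intro h
  have := congrArg (fun τ : 𝕜 →ₐ[ℝ] ℂ ↦ τ I) h
  simp only [posAlgHom_I, negAlgHom_I] at this
  exact Complex.I_ne_zero (by linear_combination this / 2)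

/-- In the complex case every real-algebra map `𝕜 → ℂ` is `posAlgHom` or `negAlgHom`.
(Compare `Complex.real_algHom_eq_id_or_conj`.) [folklore] -/
theorem algHom_eq_pos_or_neg (hI : im (I : 𝕜) = 1) (τ : 𝕜 →ₐ[ℝ] ℂ) :
    τ = posAlgHom hI ∨ τ = negAlgHom hI := by
  have hI0 : (I : 𝕜) ≠ 0 := fun h ↦ by simp [h] at hI
  rcases algHom_I_eq τ with ⟨h0, -⟩ | ⟨-, h | h⟩
  · exact absurd h0 hI0
  · exact Or.inl (algHom_ext_I (by rw [h, posAlgHom_I]))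
  · exact Or.inr (algHom_ext_I (by rw [h, negAlgHom_I]))

open scoped Classical in
/-- In the complex case `T = {posAlgHom, negAlgHom}`. [folklore] -/
theorem univ_eq_of_im_I (hI : im (I : 𝕜) = 1) :
    (Finset.univ : Finset (𝕜 →ₐ[ℝ] ℂ)) = {posAlgHom hI, negAlgHom hI} := by
  ext τ
  simp only [Finset.mem_univ, Finset.mem_insert, Finset.mem_singleton, true_iff]
  exact algHom_eq_pos_or_neg hI τ

/-- `|T| = 1` in the real case. [folklore] -/
theorem card_algHom_of_I_eq_zero (hI : (I : 𝕜) = 0) : Fintype.card (𝕜 →ₐ[ℝ] ℂ) = 1 := by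
  rw [Fintype.card_eq_one_iff]
  exact ⟨reAlgHom hI, fun τ ↦ algHom_eq_of_I_eq_zero hI τ _⟩

/-- `|T| = 2` in the complex case. [folklore] -/
theorem card_algHom_of_im_I (hI : im (I : 𝕜) = 1) : Fintype.card (𝕜 →ₐ[ℝ] ℂ) = 2 := by
  classical
  rw [← Finset.card_univ, univ_eq_of_im_I hI, Finset.card_pair (posAlgHom_ne_negAlgHom hI)]

/-- Sums over `T` in the real case. [folklore] -/
theorem sum_eq_of_I_eq_zero {M : Type*} [AddCommMonoid M] (hI : (I : 𝕜) = 0)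
    (f : (𝕜 →ₐ[ℝ] ℂ) → M) (τ : 𝕜 →ₐ[ℝ] ℂ) : ∑ τ', f τ' = f τ := by
  have : (Finset.univ : Finset (𝕜 →ₐ[ℝ] ℂ)) = {τ} := by
    ext τ'; simpa using algHom_eq_of_I_eq_zero hI τ' τ
  rw [this, Finset.sum_singleton]

/-- Sums over `T` in the complex case. [folklore] -/
theorem sum_eq_of_im_I {M : Type*} [AddCommMonoid M] (hI : im (I : 𝕜) = 1)
    (f : (𝕜 →ₐ[ℝ] ℂ) → M) : ∑ τ, f τ = f (posAlgHom hI) + f (negAlgHom hI) := by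
  classical
  rw [univ_eq_of_im_I hI, Finset.sum_pair (posAlgHom_ne_negAlgHom hI)]

/-- `∑_τ τ(I) = 0` (uniformly in the real and complex cases). [folklore] -/
theorem sum_algHom_I : ∑ τ : 𝕜 →ₐ[ℝ] ℂ, τ I = 0 := by
  rcases RCLike.I_eq_zero_or_im_I_eq_one (K := 𝕜) with h | h
  · exact Finset.sum_eq_zero fun τ _ ↦ by rw [h, map_zero]
  · rw [sum_eq_of_im_I h, posAlgHom_I, negAlgHom_I, add_neg_cancel]

/-- `T` is nonempty, so `|T| ≠ 0` in `ℂ`. [folklore] -/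
theorem card_algHom_ne_zero : (Fintype.card (𝕜 →ₐ[ℝ] ℂ) : ℂ) ≠ 0 := by
  rcases RCLike.I_eq_zero_or_im_I_eq_one (K := 𝕜) with h | h
  · rw [card_algHom_of_I_eq_zero h]; norm_num
  · rw [card_algHom_of_im_I h]; norm_num

open scoped Classical in
/-- **Orthogonality of the embeddings**: `|T|⁻¹ (1 + conj(τ I) τ'(I)) = δ_{ττ'}`. This is the
statement that the elements `e_τ = |T|⁻¹ (1 ⊗ 1 + I ⊗ conj(τ I))` are the primitive idempotents of
`𝕜 ⊗_ℝ ℂ ≅ ∏_τ ℂ`. Knapp, §VI.1. [folklore] -/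
theorem orthogonality (τ τ' : 𝕜 →ₐ[ℝ] ℂ) :
    (Fintype.card (𝕜 →ₐ[ℝ] ℂ) : ℂ)⁻¹ * (1 + conj (τ I) * τ' I) = if τ = τ' then 1 else 0 := by
  rcases RCLike.I_eq_zero_or_im_I_eq_one (K := 𝕜) with h | h
  · rw [card_algHom_of_I_eq_zero h, if_pos (algHom_eq_of_I_eq_zero h τ τ'), h, map_zero]
    simp
  · have hI0 : (I : 𝕜) ≠ 0 := fun h' ↦ by simp [h'] at h
    rw [card_algHom_of_im_I h]
    split_ifs with hττ'
    · subst hττ'; rw [conj_algHom_I_mul_self τ hI0]; norm_num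
    · have hne : τ' I = -τ I := by
        rcases algHom_eq_pos_or_neg h τ with rfl | rfl <;>
          rcases algHom_eq_pos_or_neg h τ' with rfl | rfl <;>
          simp_all
      rw [hne, mul_neg, conj_algHom_I_mul_self τ hI0]; norm_num

/-- Orthogonality in summed form: `|T|⁻¹ ∑_τ' (1 + conj(τ I) τ'(I)) • S τ' = S τ`. [folklore] -/
theorem orthogonality_sum {W : Type*} [AddCommGroup W] [Module ℂ W] (S : (𝕜 →ₐ[ℝ] ℂ) → W)
    (τ : 𝕜 →ₐ[ℝ] ℂ) :
    (Fintype.card (𝕜 →ₐ[ℝ] ℂ) : ℂ)⁻¹ • ∑ τ', (1 + conj (τ I) * τ' I) • S τ' = S τ := by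
  classical
  rw [Finset.smul_sum]
  simp_rw [smul_smul, orthogonality, ite_smul, one_smul, zero_smul]
  rw [Finset.sum_ite_eq]; simp

/-! ### `τ`-projectors of a real-linear map -/

section Proj

variable {M : Type*} [AddCommGroup M] [Module 𝕜 M] {W : Type*} [AddCommGroup W] [Module ℂ W]

/-- The **`τ`-projector** of a real-linear map `ρ : M → W` (`M` a `𝕜`-module, `W` a complex vector
space): `proj ρ τ X = |T|⁻¹ (ρ X + conj(τ I) ρ(I • X))`, the `τ`-component of the complex-linear
extension of `ρ` to `M ⊗_ℝ ℂ = ⨁_τ M ⊗_{𝕜,τ} ℂ`. Knapp, §VI.1. [folklore] -/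
def proj (ρ : M → W) (τ : 𝕜 →ₐ[ℝ] ℂ) (X : M) : W :=
  (Fintype.card (𝕜 →ₐ[ℝ] ℂ) : ℂ)⁻¹ • (ρ X + conj (τ I) • ρ ((I : 𝕜) • X))

/-- Unfolding `proj`. [folklore] -/
theorem proj_def (ρ : M → W) (τ : 𝕜 →ₐ[ℝ] ℂ) (X : M) :
    proj ρ τ X = (Fintype.card (𝕜 →ₐ[ℝ] ℂ) : ℂ)⁻¹ • (ρ X + conj (τ I) • ρ ((I : 𝕜) • X)) := rfl

/-- `∑_τ proj ρ τ X = ρ X`. [folklore] -/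
theorem sum_proj (ρ : M →+ W) (X : M) : ∑ τ : 𝕜 →ₐ[ℝ] ℂ, proj ρ τ X = ρ X := by
  simp only [proj_def, ← Finset.smul_sum, Finset.sum_add_distrib, ← Finset.sum_smul,
    Finset.sum_const, Finset.card_univ]
  have : ∑ τ : 𝕜 →ₐ[ℝ] ℂ, conj (τ I) = 0 := by
    rw [← map_sum, sum_algHom_I, map_zero]
  rw [this, zero_smul, add_zero, ← Nat.cast_smul_eq_nsmul ℂ, smul_smul,
    inv_mul_cancel₀ card_algHom_ne_zero, one_smul]

/-- `proj ρ τ` is additive. [folklore] -/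
theorem proj_add (ρ : M →+ W) (τ : 𝕜 →ₐ[ℝ] ℂ) (X Y : M) :
    proj ρ τ (X + Y) = proj ρ τ X + proj ρ τ Y := by
  simp only [proj_def, smul_add, map_add]; abel

/-- `proj ρ τ 0 = 0`. [folklore] -/
theorem proj_zero (ρ : M →+ W) (τ : 𝕜 →ₐ[ℝ] ℂ) : proj ρ τ 0 = 0 := by
  simp [proj_def]

/-- `proj ρ τ (-X) = -proj ρ τ X`. [folklore] -/
theorem proj_neg (ρ : M →+ W) (τ : 𝕜 →ₐ[ℝ] ℂ) (X : M) : proj ρ τ (-X) = -proj ρ τ X := by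
  simp [proj_def, smul_neg]; abel

/-- `proj ρ τ` commutes with finite sums. [folklore] -/
theorem proj_sum (ρ : M →+ W) (τ : 𝕜 →ₐ[ℝ] ℂ) {ι : Type*} (s : Finset ι) (f : ι → M) :
    proj ρ τ (∑ i ∈ s, f i) = ∑ i ∈ s, proj ρ τ (f i) := by
  classical
  induction s using Finset.induction_on with
  | empty => simp [proj_zero]
  | insert a s ha ih => rw [Finset.sum_insert ha, Finset.sum_insert ha, proj_add, ih]

/-- Scalar bookkeeping for `proj_smul`. [folklore] -/
private theorem smul_identity {V : Type*} [AddCommGroup V] [Module ℂ V] (c r s t imI : ℂ)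
    (u v : V) (hA : t * imI = t) (hB : s * (1 + t * t) = 0) :
    c • (r • u + s • v + (-t) • ((-(s * imI)) • u + r • v)) = (r + s * t) • c • (u + (-t) • v) := by
  simp only [smul_add, smul_smul]
  rw [show ∀ (p q p' q' : ℂ), p • u + q • v + (p' • u + q' • v) = (p + p') • u + (q + q') • v
    from fun p q p' q' ↦ by rw [add_smul, add_smul]; abel]
  congr 1
  · congr 1; linear_combination c * s * hA
  · congr 1; linear_combination c * hB

variable [Module ℝ M] [IsScalarTower ℝ 𝕜 M] [Module ℝ W] [IsScalarTower ℝ ℂ W]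

/-- **`τ`-semilinearity** of the projector: `proj ρ τ (a • X) = τ(a) • proj ρ τ X`. [folklore] -/
theorem proj_smul (ρ : M →ₗ[ℝ] W) (τ : 𝕜 →ₐ[ℝ] ℂ) (a : 𝕜) (X : M) :
    proj ρ τ (a • X) = τ a • proj ρ τ X := by
  have hreal : ∀ (r : ℝ) (Y : M), ρ ((r : 𝕜) • Y) = (r : ℂ) • ρ Y := fun r Y ↦ by
    rw [algebraMap_smul, map_smul, ← algebraMap_smul ℂ r (ρ Y)]; rfl
  have ha : a • X = ((re a : ℝ) : 𝕜) • X + ((im a : ℝ) : 𝕜) • ((I : 𝕜) • X) := by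
    rw [smul_smul, ← add_smul, re_add_im]
  have hIa : (I : 𝕜) • (a • X) = ((-(im a * im (I : 𝕜)) : ℝ) : 𝕜) • X +
      ((re a : ℝ) : 𝕜) • ((I : 𝕜) • X) := by
    rw [smul_smul, smul_smul, ← add_smul]
    congr 1
    apply RCLike.ext
    · simp [mul_re]
    · simp [mul_im, mul_comm]
  -- the two scalar facts, by cases on `𝕜 = ℝ` / `𝕜 = ℂ`
  have hAB : τ I * (im (I : 𝕜) : ℂ) = τ I ∧ (im a : ℂ) * (1 + τ I * τ I) = 0 := by
    rcases RCLike.I_eq_zero_or_im_I_eq_one (K := 𝕜) with h | h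
    · refine ⟨by rw [h, map_zero, zero_mul], ?_⟩
      rw [im_eq_zero h a, Complex.ofReal_zero, zero_mul]
    · refine ⟨by rw [h, Complex.ofReal_one, mul_one], ?_⟩
      have hI0 : (I : 𝕜) ≠ 0 := fun h' ↦ by simp [h'] at h
      rw [← map_mul, I_mul_I_of_nonzero hI0, map_neg, map_one, add_neg_cancel, mul_zero]
  rw [proj_def, proj_def, hIa, ha, map_add, map_add, hreal, hreal, hreal, hreal,
    algHom_apply_eq τ a, conj_algHom_I, Complex.ofReal_neg, Complex.ofReal_mul]
  exact smul_identity _ _ _ _ _ _ _ hAB.1 hAB.2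

omit [Module ℝ M] [IsScalarTower ℝ 𝕜 M] [Module ℝ W] [IsScalarTower ℝ ℂ W] in
/-- The projector of a map vanishing on a `𝕜`-submodule vanishes there. [folklore] -/
theorem proj_eq_zero_of {ρ : M → W} {N : Submodule 𝕜 M} {X : M} (hX : X ∈ N)
    (h : ∀ Y ∈ N, ρ Y = 0) (τ : 𝕜 →ₐ[ℝ] ℂ) : proj ρ τ X = 0 := by
  rw [proj_def, h X hX, h _ (N.smul_mem _ hX), smul_zero, add_zero, smul_zero]

end Proj

end Literature.NumberTheory.Automorphic.HCEmb
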